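import Summits.QuantumFields.YangMills.Theses.QuantileBitPurity
import Summits.QuantumFields.YangMills.Theorems.ToronSmallBallOwnAxisShiftWindowGen
import Summits.QuantumFields.YangMills.Theorems.ToronSmallBallOwnAxisShiftNumericsR
import Summits.QuantumFields.YangMills.Theorems.QuantileBitPurityFluxSuppression
import Summits.QuantumFields.YangMills.Theorems.QuantileBitPuritySectors
import HarnessLib

/-!
# `QuantileBitPurity.HolonomyLevyWindowDeep` (item stmt-QuantumFields-23949) — PROVED: the deep Lévy window WITHOUT the equator restriction

Route `QuantileBitPurity` crux r3 in its UNRESTRICTED form (cap `2/5`, every centre `c ≥ β^(−γc)`, the equator included): for every `γc ≤ 2/5`,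
with `a₀ = 1/1600`, for every `0 < a ≤ a₀`, `γ = 1/2 − 4a`, `β ≥ β₀(a)`, `2 ≤ L ≤ β^a` and every centre `c ≥ β^(−γc)` the ring-inserted trace of
the slice-`0` strip `{|polDist U − c| ≤ β^(−γ)}` on the `L`-ring is `≤ β^(−a) · Z_phys(L)`.

METHOD.  Sector decomposition (`TT.ringInsTrace_indicator_zero_eq_sum_sectorWeight`).  In the four sectors WITHOUT `x`-twist: the own-axis class
shift of seat g15 verbatim (`OwnAxis.sectorWeight_stripGen_le_rpow_of_numerics`, constant slice functional `f ≡ c`, core radius `c − 2w ≥ β^(−2/5) − 2w`,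
numerics `OwnAxis.numericsR_of_le`) — it needs no upper bound on the centre.  In the four sectors WITH `x`-twist — where the restricted version
`HolonomyLevyWindowDeepR` ⟨24092⟩ had to keep the strip below the level `2 − L²η` — FLUX REFLECTION (seat g17, `Flux.sectorWeight_twisted_le_rpow_odd/
_even` at window exponent `4a`): the WHOLE `x`-twisted sector carries at most `13β^(−2a) ≤ β^(−a)` of `Z_phys`, whatever the centre.

HONEST FRAMING: one crux of route `QuantileBitPurity` (superseded in the route's deciding theorem by ⟨24092⟩, closed here for the record together with its
cap-`1/5` version ⟨23923⟩); fixed-lattice estimate on a femto window; nothing about infinite volume, the continuum limit or the Clay Yang–Mills gap — the YM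
mass gap is NOT proved.  No `sorry`, no new axiom, no new definition.  References: [cite: Luscher1983, §2]; [cite: tHooft1979]; [cite: MontvayMunster1994, (3.145)].
-/

set_option autoImplicit false

noncomputable section

open MeasureTheory Set Function
open scoped BigOperators
open Literature.MathematicalPhysics.QuantumFieldTheory hiding su2Quat_mul SU2
open Summit.QuantumFields.YangMills.Theorems.FemtoTransferGap
open Summit.QuantumFields.YangMills.Theorems.FemtoTransferGap.TT
open Summit.QuantumFields.YangMills.Theorems.FemtoTransferGap.FlatSheet

namespace Summit.QuantumFields.YangMills.Theorems.QuantileBitPurity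

set_option maxHeartbeats 800000 in
/-- ★ **`QuantileBitPurity.HolonomyLevyWindowDeep` holds** (item stmt-QuantumFields-23949, BY NAME): the deep Lévy window at every centre
`c ≥ β^(−γc)`, by the own-axis class shift (untwisted sectors) and flux reflection (`x`-twisted sectors).  The YM mass gap is NOT proved.
[cite: Luscher1983, §2] [cite: tHooft1979] [cite: MontvayMunster1994, (3.145)] -/
theorem holonomyLevyWindowDeep_proof : Summit.QuantumFields.YangMills.Theses.QuantileBitPurity.HolonomyLevyWindowDeep := by
  intro γc hγc
  refine ⟨1 / 1600, by norm_num, by norm_num, fun a ha ha' => ?_⟩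
  have ha400 : a ≤ 1 / 400 := by linarith
  have h4a : 0 < 4 * a := by linarith
  have h4a' : 4 * a ≤ 1 / 400 := by linarith
  obtain ⟨β₀, hβ₀⟩ := OwnAxis.numericsR_of_le ha ha400
  obtain ⟨βe, he⟩ := Flux.sectorWeight_twisted_le_rpow_even (a := 4 * a) h4a h4a'
  obtain ⟨βo, ho⟩ := Flux.sectorWeight_twisted_le_rpow_odd (a := 4 * a) h4a h4a'
  refine ⟨1 / 2 - 4 * a, by linarith, max β₀ (max (max βe βo) ((13 : ℝ) ^ (1 / (-(-a))))), 2, fun β hβ L _ hL2 hLβ c hc1 => ?_⟩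
  have hββ₀ : β₀ ≤ β := le_trans (le_max_left _ _) hβ
  have hβe : βe ≤ β := le_trans (le_trans (le_trans (le_max_left _ _) (le_max_left _ _)) (le_max_right _ _)) hβ
  have hβo : βo ≤ β := le_trans (le_trans (le_trans (le_max_right _ _) (le_max_left _ _)) (le_max_right _ _)) hβ
  have h13 : (13 : ℝ) ^ (1 / (-(-a))) ≤ β := le_trans (le_trans (le_max_right _ _) (le_max_right _ _)) hβ
  have hL1 : 1 ≤ L := le_trans (by norm_num) hL2
  obtain ⟨⟨h200, hη, hw, hθ', hσ, hσ1, -, hK, hKσ, hQ, hJ, hG, hKa⟩, hstrip⟩ := hβ₀ β hββ₀ L hL1 hLβ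
  have hβ1 : 1 ≤ β := le_trans (by norm_num) h200
  have hβ0 : 0 < β := lt_of_lt_of_le (by norm_num) h200
  -- the core exponent: `β^{-2/5} ≤ β^{-γc} ≤ c`
  have hcore : β ^ (-(2 / 5 : ℝ)) ≤ β ^ (-γc) := Real.rpow_le_rpow_of_exponent_le hβ1 (by linarith)
  have hc1' : β ^ (-(2 / 5 : ℝ)) ≤ c := hcore.trans hc1
  -- the ring: `n = L - 1`, `n + 1 = L ≤ 2L`
  have hn1 : 1 ≤ L - 1 := by omega
  have hn2 : L - 1 + 1 ≤ 2 * L := by omega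
  have hZ : physTrace L β L = physTraceSucc L β (L - 1) := rfl
  have hZ0 : 0 ≤ physTraceSucc L β (L - 1) := OwnAxis.physTraceSucc_nonneg_of (L := L) hn1 h200
  -- the flux window `L ≤ β^{4a}` and the rate `13 β^{−2a} ≤ β^{−a}`
  have hLβ4 : (L : ℝ) ≤ β ^ (4 * a) := hLβ.trans (Real.rpow_le_rpow_of_exponent_le hβ1 (by linarith))
  have hrate : 13 * β ^ (-(4 * a / 2)) ≤ β ^ (-a) := by
    have key : 13 * β ^ (-a) ≤ 1 := OwnAxis.mul_rpow_le_one_of_le (by norm_num) (by linarith) h13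
    have hsplit : β ^ (-(4 * a / 2)) = β ^ (-a) * β ^ (-a) := by rw [← Real.rpow_add hβ0]; ring_nf
    have h0 : 0 ≤ β ^ (-a) := Real.rpow_nonneg hβ0.le _
    rw [hsplit, ← mul_assoc]
    calc 13 * β ^ (-a) * β ^ (-a) ≤ 1 * β ^ (-a) := mul_le_mul_of_nonneg_right key h0
      _ = β ^ (-a) := one_mul _
  -- the `x`-twisted sectors, both ring parities
  have hthin : ∀ n : ℕ, 1 ≤ n → n + 1 ≤ 2 * L → ∀ z : Fin 3 → Bool, z 0 = true →
      sectorWeight (L := L) β n z (fun _ _ => (1 : ℝ)) ≤ 13 * β ^ (-(4 * a / 2)) * physTraceSucc L β n := by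
    intro n hn1' hn2' z hz
    obtain ⟨q, rfl | rfl⟩ : ∃ q : ℕ, n = 1 + (q + q) ∨ n = 1 + (q + 1 + q) := ⟨(n - 1) / 2, by omega⟩
    · exact he β hβe L hLβ4 q hn2' z hz
    · exact ho β hβo L hLβ4 q hn2' z hz
  -- the strip event
  have hA : MeasurableSet {U : GaugeConfig 3 L SU2 | |polDist U - c| ≤ β ^ (-(1 / 2 - 4 * a))} :=
    measurableSet_le ((measurable_polDist.sub measurable_const).abs) measurable_const
  have hFm : Measurable (uncurry fun (Us : Fin (L - 1 + 1) → GaugeConfig 3 L SU2) (_g : Site 3 L → SU2) =>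
      {U : GaugeConfig 3 L SU2 | |polDist U - c| ≤ β ^ (-(1 / 2 - 4 * a))}.indicator (fun _ => (1 : ℝ)) (Us 0)) :=
    measurable_uncurry_slice_zero (measurable_const.indicator hA)
  rw [ringInsTrace_indicator_zero_eq_sum_sectorWeight β (L - 1) hA, hZ]
  -- every sector carries at most `β^{-a} Z_phys`
  have hsector : ∀ z : Fin 3 → Bool,
      sectorWeight β (L - 1) z (fun Us _ =>
        {U : GaugeConfig 3 L SU2 | |polDist U - c| ≤ β ^ (-(1 / 2 - 4 * a))}.indicator (fun _ => (1 : ℝ)) (Us 0)) ≤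
      β ^ (-a) * physTraceSucc L β (L - 1) := by
    intro z
    cases hz : z 0
    · -- no `x`-twist: the own-axis class shift with the constant slice functional `f ≡ c` and core radius `c - 2w`
      have hsub : {U : GaugeConfig 3 L SU2 | |polDist U - c| ≤ β ^ (-(1 / 2 - 4 * a))} ⊆
          {U : GaugeConfig 3 L SU2 | |polDist U - (fun _ : GaugeConfig 3 L SU2 => c) U| ≤ β ^ (-(1 / 2 - 4 * a)) ∧
            c - 2 * β ^ (-(1 / 2 - 4 * a)) < polDist U} := by
        intro U hU
        simp only [Set.mem_setOf_eq] at hU ⊢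
        refine ⟨hU, ?_⟩
        have h := (abs_le.1 hU).1
        linarith
      have hGm : Measurable (uncurry fun (Us : Fin (L - 1 + 1) → GaugeConfig 3 L SU2) (_g : Site 3 L → SU2) =>
          {U : GaugeConfig 3 L SU2 | |polDist U - (fun _ : GaugeConfig 3 L SU2 => c) U| ≤ β ^ (-(1 / 2 - 4 * a)) ∧
            c - 2 * β ^ (-(1 / 2 - 4 * a)) < polDist U}.indicator (fun _ => (1 : ℝ)) (Us 0)) :=
        measurable_uncurry_slice_zero (measurable_const.indicator (OwnAxis.measurableSet_stripGen (L := L) measurable_const _ _))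
      have hmono := sectorWeight_mono (L := L) β (L - 1) z (C := 1) hFm hGm
        (fun Us _ => abs_indicator_one_le _ (Us 0)) (fun Us _ => abs_indicator_one_le _ (Us 0))
        (fun Us _ => Set.indicator_le_indicator_of_subset hsub (fun _ => zero_le_one) (Us 0))
      have hfl : 4 * ((L : ℝ) * (L * β ^ (-(19 / 40 : ℝ)))) ≤ (c - 2 * β ^ (-(1 / 2 - 4 * a))) / 2 - β ^ (-(2 / 5 : ℝ)) / 4 := by
        linarith
      have hwin := OwnAxis.sectorWeight_stripGen_le_rpow_of_numerics (L := L) hz (f := fun _ : GaugeConfig 3 L SU2 => c) measurable_const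
        (fun _ _ => rfl) hn1 hn2 (a := a) (η := β ^ (-(19 / 40 : ℝ))) (w := β ^ (-(1 / 2 - 4 * a)))
        (c₀ := c - 2 * β ^ (-(1 / 2 - 4 * a))) (σ := β ^ (-(2 / 5 : ℝ)) / 4) (θ' := 6 * β ^ (-(1 / 2 - 4 * a))) (K := ⌈64 * Real.exp 1 * β ^ a⌉₊)
        h200 hη hw hθ' hσ hσ1 hfl hK hKσ hQ hJ hG hKa
      exact hmono.trans hwin
    · -- `x`-twist: the whole sector is small by flux reflection
      have hGm : Measurable (uncurry fun (_Us : Fin (L - 1 + 1) → GaugeConfig 3 L SU2) (_g : Site 3 L → SU2) => (1 : ℝ)) :=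
        measurable_const
      have hmono := sectorWeight_mono (L := L) β (L - 1) z (C := 1) hFm hGm
        (fun Us _ => abs_indicator_one_le _ (Us 0)) (fun _ _ => by rw [abs_one])
        (fun Us _ => Set.indicator_apply_le' (fun _ => le_rfl) (fun _ => zero_le_one))
      exact hmono.trans ((hthin (L - 1) hn1 hn2 z hz).trans (mul_le_mul_of_nonneg_right hrate hZ0))
  -- sum over the eight sectors
  have hsum := Finset.sum_le_sum fun z (_ : z ∈ (Finset.univ : Finset (Fin 3 → Bool))) => hsector z
  rw [Finset.sum_const, Finset.card_univ, Fintype.card_fun, Fintype.card_bool, Fintype.card_fin, nsmul_eq_mul] at hsum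
  rw [show ((2 ^ 3 : ℕ) : ℝ) = 8 by norm_num] at hsum
  have hε8 : (1 / 8 : ℝ) * (8 * (β ^ (-a) * physTraceSucc L β (L - 1))) = β ^ (-a) * physTraceSucc L β (L - 1) := by ring
  exact (mul_le_mul_of_nonneg_left hsum (by norm_num)).trans hε8.le

end Summit.QuantumFields.YangMills.Theorems.QuantileBitPurity

end
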